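import Summits.CriticalPhenomena.PercolationContinuityZ3.Theorems.Transplant.Slab111HubXData
import HarnessLib

/-!
# The HUB ROUTING of the `(111)`-films, II-X (exact ride windows): the legs against the pieces, and the hub adjacencies

builds on p205010 (kernel theorem, internal audit signed; external expert review pending) — NOT used in this file.  Lane `prim-bschramm`, seat
`prim-bschramm-p2` (gen 37; class C1b; memo `HOME/bschramm/P2-LATTICES.md` §135); helper file (`--supports stmt-CriticalPhenomena-4575 --as helper`).
Continuation of «Slab111HubXData»: for a `HubDataX` `D`, the three legs meet the `F1`-segment only at `e₁` / not at all, meet the `F2`- and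
`F3`-segments only at their own end, avoid the two hubs and each other, and lie in the regions; the hubs are adjacent to `c`, `d` and to the
attachment vertices of `F2`, `F3`.  Used by the two routings («Slab111HubXRoute1», «Slab111HubXRoute2»).
[cite: DuminilCopinSidoraviciusTassion2016, §2.3 (proof of Fact 2: the three disjoint paths γ_u, γ_v, γ_w in B_R(z))]
-/

noncomputable section

namespace Summit.CriticalPhenomena.PercolationContinuityZ3.Theorems.Transplant

open Literature.Probability.Percolation Literature.Probability.LatticeModels SimpleGraph
open scoped Classical

namespace Slab111

namespace HubDataX

variable {k : ℕ} {z : Site 2} {c0 : ℤ} {W PR : Set (slab111 k)} {E₁ E₂ w' : slab111 k} (X : HubDataX k z c0 W PR E₁ E₂ w')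

/-- `e₁ ∈ S1`, `e₁ ∈ S1c`. [folklore] -/
theorem e1_mem : X.e₁ ∈ X.S1 ∧ X.e₁ ∈ X.S1c := ⟨X.gS1.head_mem, X.gS1c.head_mem⟩

/-- `e₂` ends every `S2 L`. [folklore] -/
theorem e2_mem {L : ℤ} (hL : X.IsHub L) : X.e₂ ∈ X.S2 L := (X.S2_facts hL).1.last_mem

/-- `e₃` ends every `S3 L`. [folklore] -/
theorem e3_mem {L : ℤ} (hL : X.IsHub L) : X.e₃ ∈ X.S3 L := (X.S3_facts hL).1.last_mem

/-- `LA` is a hub level. [folklore] -/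
theorem isHub_A : X.IsHub X.LA := Or.inl rfl
/-- `LD` is a hub level. [folklore] -/
theorem isHub_D : X.IsHub X.LD := Or.inr rfl

/-! ## Legs against the segments -/

/-- A vertex of `leg₁` on `S1` is `e₁`. [folklore] -/
theorem l1_S1 : ∀ v ∈ X.leg₁, v ∈ X.S1 → v = X.e₁ := by
  intro v hv hvS; by_contra hne; exact X.S1_clear (X.hL1 v hv hne).1 hvS

/-- `leg₂` misses `S1`. [folklore] -/
theorem l2_S1 : ∀ v ∈ X.leg₂, v ∉ X.S1 := by
  intro v hv hvS
  by_cases hve : v = X.e₂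
  · exact X.S1_S2 X.isHub_A v hvS (hve ▸ X.e2_mem X.isHub_A)
  · exact X.S1_clear (X.hL2 v hv hve).1 hvS

/-- `leg₃` misses `S1`. [folklore] -/
theorem l3_S1 : ∀ v ∈ X.leg₃, v ∉ X.S1 := by
  intro v hv hvS
  by_cases hve : v = X.e₃
  · exact X.S1_S3 X.isHub_A v hvS (hve ▸ X.e3_mem X.isHub_A)
  · exact X.S1_clear (X.hL3 v hv hve).1 hvS

/-- `leg₁` misses every `S2 L`. [folklore] -/
theorem l1_S2 {L : ℤ} (hL : X.IsHub L) : ∀ v ∈ X.leg₁, v ∉ X.S2 L := by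
  intro v hv hvS
  by_cases hve : v = X.e₁
  · exact X.S1_S2 hL _ X.e1_mem.1 (hve ▸ hvS)
  · exact (X.S2_facts hL).2.2.1 v (X.hL1 v hv hve).2.1 hvS

/-- `leg₁` misses every `S3 L`. [folklore] -/
theorem l1_S3 {L : ℤ} (hL : X.IsHub L) : ∀ v ∈ X.leg₁, v ∉ X.S3 L := by
  intro v hv hvS
  by_cases hve : v = X.e₁
  · exact X.S1_S3 hL _ X.e1_mem.1 (hve ▸ hvS)
  · exact (X.S3_facts hL).2.2.1 v (X.hL1 v hv hve).2.2.1 hvS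

/-- A vertex of `leg₂` on `S2 L` is `e₂`. [folklore] -/
theorem l2_S2 {L : ℤ} (hL : X.IsHub L) : ∀ v ∈ X.leg₂, v ∈ X.S2 L → v = X.e₂ := by
  intro v hv hvS; by_contra hne; exact (X.S2_facts hL).2.2.1 v (X.hL2 v hv hne).2.1 hvS

/-- `leg₂` misses every `S3 L`. [folklore] -/
theorem l2_S3 {L : ℤ} (hL : X.IsHub L) : ∀ v ∈ X.leg₂, v ∉ X.S3 L := by
  intro v hv hvS
  by_cases hve : v = X.e₂
  · exact X.S2_S3 X.isHub_A hL _ (X.e2_mem X.isHub_A) (hve ▸ hvS)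
  · exact (X.S3_facts hL).2.2.1 v (X.hL2 v hv hve).2.2.1 hvS

/-- `leg₃` misses every `S2 L`. [folklore] -/
theorem l3_S2 {L : ℤ} (hL : X.IsHub L) : ∀ v ∈ X.leg₃, v ∉ X.S2 L := by
  intro v hv hvS
  by_cases hve : v = X.e₃
  · exact X.S2_S3 hL X.isHub_A v hvS (hve ▸ X.e3_mem X.isHub_A)
  · exact (X.S2_facts hL).2.2.1 v (X.hL3 v hv hve).2.1 hvS

/-- A vertex of `leg₃` on `S3 L` is `e₃`. [folklore] -/
theorem l3_S3 {L : ℤ} (hL : X.IsHub L) : ∀ v ∈ X.leg₃, v ∈ X.S3 L → v = X.e₃ := by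
  intro v hv hvS; by_contra hne; exact (X.S3_facts hL).2.2.1 v (X.hL3 v hv hne).2.2.1 hvS

/-! ## Legs against the hubs, each other, and the regions -/

/-- `leg₁` avoids the hubs. [folklore] -/
theorem l1_hub {L : ℤ} (hL : X.IsHub L) : ∀ v ∈ X.leg₁, v ≠ hubV k z L := by
  intro v hv h
  by_cases hve : v = X.e₁
  · exact X.hub_S1 hL (h ▸ hve ▸ X.e1_mem.1)
  · exact X.ne_hub_of_cond (X.hL1 v hv hve).2.2.2.1 hL h

/-- `leg₂` avoids the hubs. [folklore] -/
theorem l2_hub {L : ℤ} (hL : X.IsHub L) : ∀ v ∈ X.leg₂, v ≠ hubV k z L := by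
  intro v hv h
  by_cases hve : v = X.e₂
  · exact (X.S2_facts X.isHub_A).2.2.2.1 hL (h ▸ hve ▸ X.e2_mem X.isHub_A)
  · exact X.ne_hub_of_cond (X.hL2 v hv hve).2.2.2.1 hL h

/-- `leg₃` avoids the hubs. [folklore] -/
theorem l3_hub {L : ℤ} (hL : X.IsHub L) : ∀ v ∈ X.leg₃, v ≠ hubV k z L := by
  intro v hv h
  by_cases hve : v = X.e₃
  · exact (X.S3_facts X.isHub_A).2.2.2.1 hL (h ▸ hve ▸ X.e3_mem X.isHub_A)
  · exact X.ne_hub_of_cond (X.hL3 v hv hve).2.2.2.1 hL h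

/-- `leg₁` and `leg₂` are disjoint. [folklore] -/
theorem l12 : ∀ v ∈ X.leg₁, v ∉ X.leg₂ := by
  intro v hv hv2
  by_cases h1 : v = X.e₁
  · exact X.l2_S1 v hv2 (h1 ▸ X.e1_mem.1)
  by_cases h2 : v = X.e₂
  · exact X.l1_S2 X.isHub_A v hv (h2 ▸ X.e2_mem X.isHub_A)
  · exact X.hL12 v hv h1 v hv2 h2 rfl

/-- `leg₁` and `leg₃` are disjoint. [folklore] -/
theorem l13 : ∀ v ∈ X.leg₁, v ∉ X.leg₃ := by
  intro v hv hv3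
  by_cases h1 : v = X.e₁
  · exact X.l3_S1 v hv3 (h1 ▸ X.e1_mem.1)
  by_cases h3 : v = X.e₃
  · exact X.l1_S3 X.isHub_A v hv (h3 ▸ X.e3_mem X.isHub_A)
  · exact X.hL13 v hv h1 v hv3 h3 rfl

/-- `leg₂` and `leg₃` are disjoint. [folklore] -/
theorem l23 : ∀ v ∈ X.leg₂, v ∉ X.leg₃ := by
  intro v hv hv3
  by_cases h2 : v = X.e₂
  · exact X.l3_S2 X.isHub_A v hv3 (h2 ▸ X.e2_mem X.isHub_A)
  by_cases h3 : v = X.e₃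
  · exact X.l2_S3 X.isHub_A v hv (h3 ▸ X.e3_mem X.isHub_A)
  · exact X.hL23 v hv h2 v hv3 h3 rfl

/-- `leg₁ ∖ {E₁} ⊆ PR`. [folklore] -/
theorem l1_PR : ∀ v ∈ X.leg₁, v ≠ E₁ → v ∈ PR := by
  intro v hv hvE
  by_cases hve : v = X.e₁
  · exact hve ▸ X.S1_PR _ X.e1_mem.1
  · exact (X.hL1 v hv hve).2.2.2.2 hvE

/-- `leg₂ ∖ {E₂} ⊆ PR`. [folklore] -/
theorem l2_PR : ∀ v ∈ X.leg₂, v ≠ E₂ → v ∈ PR := by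
  intro v hv hvE
  by_cases hve : v = X.e₂
  · exact hve ▸ (X.S2_facts X.isHub_A).2.1 _ (X.e2_mem X.isHub_A)
  · exact (X.hL2 v hv hve).2.2.2.2 hvE

/-- `leg₃ ⊆ W`. [folklore] -/
theorem l3_W : ∀ v ∈ X.leg₃, v ∈ W := by
  intro v hv
  by_cases hve : v = X.e₃
  · exact hve ▸ (X.S3_facts X.isHub_A).2.1 _ (X.e3_mem X.isHub_A)
  · exact (X.hL3 v hv hve).2.2.2.2

/-! ## Hub adjacencies -/

/-- The hub of level `L` is adjacent to the `F1`-vertex of level `L + d₁` (so `H_A ∼ c`, `H_D ∼ d`). [folklore] -/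
theorem adj_hub1 {L : ℤ} (hL : X.IsHub L) : (film k).Adj (hubV k z L) (rideV k z c0 X.F1 (L + X.d₁)) :=
  adj_hub_att X.hz X.hF1 X.hA1 (X.hub_facts hL).1 (X.hub_facts hL).2.1 (X.hub_facts hL).2.2.1

/-- The hub of level `L` is adjacent to the start of `S2 L`. [folklore] -/
theorem adj_hub2 {L : ℤ} (hL : X.IsHub L) : (film k).Adj (hubV k z L) (rideV k z c0 X.F2 (L + X.d₂)) :=
  adj_hub_att X.hz X.hF2 X.hA2 (X.hub_facts hL).1 (X.hub_facts hL).2.1 (X.hub_facts hL).2.2.1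

/-- The hub of level `L` is adjacent to the start of `S3 L`. [folklore] -/
theorem adj_hub3 {L : ℤ} (hL : X.IsHub L) : (film k).Adj (hubV k z L) (rideV k z c0 X.F3 (L + X.d₃)) :=
  adj_hub_att X.hz X.hF3 X.hA3 (X.hub_facts hL).1 (X.hub_facts hL).2.1 (X.hub_facts hL).2.2.1

/-- `H_A ∼ c`. [folklore] -/
theorem adj_HA_c : (film k).Adj X.HA X.c := X.adj_hub1 X.isHub_A
/-- `H_D ∼ d`. [folklore] -/
theorem adj_HD_d : (film k).Adj X.HD X.d := X.adj_hub1 X.isHub_D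

/-- The segment `HD :: S2 LD` is a path `H_D → e₂`; with `d` in front, a path `d → e₂`. [folklore] -/
theorem gT1 : GPath (film k) (X.d :: X.HD :: X.S2 X.LD) X.d X.e₂ := by
  have g := ((X.S2_facts X.isHub_D).1.cons (X.adj_hub2 X.isHub_D) ((X.S2_facts X.isHub_D).2.2.2.1 X.isHub_D))
  refine g.cons X.adj_HD_d.symm ?_
  intro h
  rcases List.mem_cons.1 h with h | h
  · exact X.hub_S1 X.isHub_D (h ▸ X.cdy_S1.2.1)
  · exact X.S1_S2 X.isHub_D _ X.cdy_S1.2.1 h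

/-- The segment `HA :: S2 LA` with `c` in front is a path `c → e₂`. [folklore] -/
theorem gT2 : GPath (film k) (X.c :: X.HA :: X.S2 X.LA) X.c X.e₂ := by
  have g := ((X.S2_facts X.isHub_A).1.cons (X.adj_hub2 X.isHub_A) ((X.S2_facts X.isHub_A).2.2.2.1 X.isHub_A))
  refine g.cons X.adj_HA_c.symm ?_
  intro h
  rcases List.mem_cons.1 h with h | h
  · exact X.hub_S1 X.isHub_A (h ▸ X.cdy_S1.1)
  · exact X.S1_S2 X.isHub_A _ X.cdy_S1.1 h

/-- The branch piece `H_L :: S3 L` is a path `H_L → e₃` off the legs' problem vertices… (basic form: a path). [folklore] -/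
theorem gB3 {L : ℤ} (hL : X.IsHub L) : GPath (film k) (hubV k z L :: X.S3 L) (hubV k z L) X.e₃ :=
  (X.S3_facts hL).1.cons (X.adj_hub3 hL) ((X.S3_facts hL).2.2.2.1 hL)

end HubDataX

end Slab111

end Summit.CriticalPhenomena.PercolationContinuityZ3.Theorems.Transplant

end
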